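import Mathlib
import Summits.NavierStokesRegularity.NavierStokesRegularity.Theorems.ThreadingFluxHorizonTowerQuadraticGeneratorAxis
import Summits.NavierStokesRegularity.NavierStokesRegularity.Theorems.ThreadingFluxHorizonTowerQuadraticGeneratorChart
import Summits.NavierStokesRegularity.NavierStokesRegularity.Theorems.ThreadingFluxHorizonTowerQuadraticGeneratorBrackets
import HarnessLib

/-!
# Crux `PoloidalLiouville` (stmt-NavierStokesRegularity-1222), crux idea «horizon-threading-tower» (ns-idea-15):
# THE QUADRATIC GENERATOR THROUGH ITS EIGENFRAME AT A COMPLEX POINT — spectral sums, Vandermonde, and the generator's zeros on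
# the complex null cone

Support file (`--supports stmt-NavierStokesRegularity-1222`, helper; cell `ns-wall-extremal`, width hand ns-wall-eng-3 g5; 0 kit).

The tool the THIRD cone digit needs when a COMPETITOR shell is free (the all-even towers `{2,4,6,8}`, `{2,4,6,10}`, `{6,8,10}`, …: the
digit reads `chartT L ∣ c₁c₂ · chartT W · chartT M` up to a unit): for a REAL traceless symmetric `Q` with `W = det(x,Qx,Q²x) ≢ 0`
(pairwise distinct eigenvalues) the null-cone chart of the generator `L = xᵀQx` has NO common root with the charts of `M = |Qx|²` and of
`W`.  Proof: a common root is a non-zero complex isotropic vector `ε` (`Σ εᵢ² = 0`) with `L(ε) = 0` and `M(ε) = 0` (for `W`: the Gram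
determinant of `(ε, Qε, Q²ε)` gives `W(ε)² = −M(ε)³` once `ρ(ε) = L(ε) = 0`); in the real orthonormal eigenframe `(b_k)` of `Q`
(`Matrix.IsHermitian.eigenvectorBasis`, F4a) the three numbers `ℓ_k = ⟨b_k, ε⟩_ℂ` satisfy the VANDERMONDE system
`Σ ℓ_k² = Σ λ_k ℓ_k² = Σ λ_k² ℓ_k² = 0`, so `ℓ = 0` and `ε = 0` when the `λ_k` are distinct; and a repeated eigenvalue makes
`Q² = βQ + γI`, `M = βL + γρ`, `4W = {L, M} = 0`.

THIS FILE (part 1 of 2): `eval_normSq_eq_sum_sq`, `eval_genL_eq_sum`, `eval_genM_eq_sum` — the spectral sums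
`ρ(ε) = Σ ℓ_k²`, `L(ε) = Σ λ_k ℓ_k²`, `M(ε) = Σ λ_k² ℓ_k²` at a COMPLEX point through the real orthonormal eigenframe (F4a);
`vandermonde_three`; `genM_eq_of_eigenvalues_sq` (converse of F4a's `eigenvalues_sq_of_genM_eq`); `genW_eq_zero_of_eigenvalues_eq` — a
repeated eigenvalue kills `W`; ★ `eq_zero_of_cone_zero` — `ρ(ε) = L(ε) = M(ε) = 0`, `W ≢ 0` ⇒ `ε = 0`.  Part 2
(`…QuadraticGeneratorCone`): the Gram identity `W(ε)² = −M(ε)³` on `{ρ = L = 0}` and ★★ `eq_zero_of_chartT_genL_dvd`.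

HONEST LABEL: polynomial algebra about the typed objects of one crux idea (tool for the order-one finite-tower programme; no tower theorem in
this file); `PoloidalLiouville` (1222) OPEN; W1 movement 0; NS regularity NOT proved.  [folklore]
-/

-- the summit and its single sub-problem share the name (CONVENTIONS §1)
set_option linter.dupNamespace false

noncomputable section

open MvPolynomial Complex
open scoped Polynomial RealInnerProductSpace
open Literature.Geometry.DiscreteGeometry (inner_fin3 norm_sq_fin3)

namespace Summit.NavierStokesRegularity.NavierStokesRegularity.Theorems.PoloidalLiouville.HorizonTower

namespace Zonal

variable (a b d e f : ℝ)

/-! ### Evaluation of the generator polynomials at a complex point -/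

/-- `ρ(ε) = Σ εᵢ²`. [folklore] -/
theorem eval_map_normSq (ε : Fin 3 → ℂ) :
    eval ε (map (algebraMap ℝ ℂ) (normSq : RPoly)) = ε 0 ^ 2 + ε 1 ^ 2 + ε 2 ^ 2 := by
  simp [normSq]

/-- `L(ε) = εᵀQε` in coordinates. [folklore] -/
theorem eval_map_genL (ε : Fin 3 → ℂ) :
    eval ε (map (algebraMap ℝ ℂ) (genL a b d e f))
      = (a : ℂ) * ε 0 ^ 2 + (b : ℂ) * ε 1 ^ 2 - ((a : ℂ) + b) * ε 2 ^ 2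
        + 2 * (d : ℂ) * ε 0 * ε 1 + 2 * (e : ℂ) * ε 0 * ε 2 + 2 * (f : ℂ) * ε 1 * ε 2 := by
  simp [genL, genQ0, genQ1, genQ2]
  ring

/-- `M(ε) = |Qε|²` (complex-bilinear) in coordinates. [folklore] -/
theorem eval_map_genM (ε : Fin 3 → ℂ) :
    eval ε (map (algebraMap ℝ ℂ) (genM a b d e f))
      = ((a : ℂ) * ε 0 + d * ε 1 + e * ε 2) ^ 2 + ((d : ℂ) * ε 0 + b * ε 1 + f * ε 2) ^ 2
        + ((e : ℂ) * ε 0 + f * ε 1 - (a + b) * ε 2) ^ 2 := by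
  simp [genM, genQ0, genQ1, genQ2]

/-! ### The spectral sums at a complex point -/

/-- Row orthonormality of the eigenframe: `Σᵢ b_m(i) b_n(i) = δ_{mn}`. [folklore] -/
theorem eigenvectorBasis_mul_sum (m n : Fin 3) :
    ∑ i : Fin 3, (genMat_isHermitian a b d e f).eigenvectorBasis m i * (genMat_isHermitian a b d e f).eigenvectorBasis n i = if m
          = n then 1 else 0 := by
  have h := orthonormal_iff_ite.mp (genMat_isHermitian a b d e f).eigenvectorBasis.orthonormal m n
  rw [← h, inner_fin3, Fin.sum_univ_three]

/-- `ρ(ε) = Σ_m ℓ_m²` with `ℓ_m = ⟨b_m, ε⟩_ℂ` (column completeness of the eigenframe). [folklore] -/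
theorem eval_normSq_eq_sum_sq (ε : Fin 3 → ℂ) :
    eval ε (map (algebraMap ℝ ℂ) (normSq : RPoly))
          = ∑ m : Fin 3, (∑ i : Fin 3, (((genMat_isHermitian a b d e f).eigenvectorBasis m i : ℝ) : ℂ) * ε i) ^ 2 := by
  have hc := fun i j => sum_eigenvectorBasis_mul a b d e f i j
  have h00 : _ = (1 : ℝ) := (hc 0 0).trans (if_pos rfl)
  have h11 : _ = (1 : ℝ) := (hc 1 1).trans (if_pos rfl)
  have h22 : _ = (1 : ℝ) := (hc 2 2).trans (if_pos rfl)
  have h01 : _ = (0 : ℝ) := (hc 0 1).trans (if_neg (by decide))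
  have h02 : _ = (0 : ℝ) := (hc 0 2).trans (if_neg (by decide))
  have h12 : _ = (0 : ℝ) := (hc 1 2).trans (if_neg (by decide))
  rw [Fin.sum_univ_three] at h00 h11 h22 h01 h02 h12
  have g00 := congrArg (fun r : ℝ => (r : ℂ)) h00
  have g11 := congrArg (fun r : ℝ => (r : ℂ)) h11
  have g22 := congrArg (fun r : ℝ => (r : ℂ)) h22
  have g01 := congrArg (fun r : ℝ => (r : ℂ)) h01
  have g02 := congrArg (fun r : ℝ => (r : ℂ)) h02
  have g12 := congrArg (fun r : ℝ => (r : ℂ)) h12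
  push_cast at g00 g11 g22 g01 g02 g12
  rw [eval_map_normSq]
  simp only [Fin.sum_univ_three]
  linear_combination (-(ε 0 ^ 2)) * g00 + (-(2 * ε 0 * ε 1)) * g01 + (-(2 * ε 0 * ε 2)) * g02 + (-(ε 1 ^ 2)) * g11
    + (-(2 * ε 1 * ε 2)) * g12 + (-(ε 2 ^ 2)) * g22

/-- The entries of `Q` through the eigenframe, cast to `ℂ`. [folklore] -/
theorem genMat_entries_eq_sum :
    ((a : ℝ) : ℂ) = ∑ m : Fin 3, (((genMat_isHermitian a b d e f).eigenvalues m : ℝ) : ℂ)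
          * (((genMat_isHermitian a b d e f).eigenvectorBasis m 0 : ℝ) : ℂ) * (((genMat_isHermitian a b d e f).eigenvectorBasis m 0 : ℝ) : ℂ)
    ∧ ((b : ℝ) : ℂ) = ∑ m : Fin 3, (((genMat_isHermitian a b d e f).eigenvalues m : ℝ) : ℂ)
          * (((genMat_isHermitian a b d e f).eigenvectorBasis m 1 : ℝ) : ℂ) * (((genMat_isHermitian a b d e f).eigenvectorBasis m 1 : ℝ) : ℂ)
    ∧ ((d : ℝ) : ℂ) = ∑ m : Fin 3, (((genMat_isHermitian a b d e f).eigenvalues m : ℝ) : ℂ)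
          * (((genMat_isHermitian a b d e f).eigenvectorBasis m 0 : ℝ) : ℂ) * (((genMat_isHermitian a b d e f).eigenvectorBasis m 1 : ℝ) : ℂ)
    ∧ ((e : ℝ) : ℂ) = ∑ m : Fin 3, (((genMat_isHermitian a b d e f).eigenvalues m : ℝ) : ℂ)
          * (((genMat_isHermitian a b d e f).eigenvectorBasis m 0 : ℝ) : ℂ) * (((genMat_isHermitian a b d e f).eigenvectorBasis m 2 : ℝ) : ℂ)
    ∧ ((f : ℝ) : ℂ) = ∑ m : Fin 3, (((genMat_isHermitian a b d e f).eigenvalues m : ℝ) : ℂ)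
          * (((genMat_isHermitian a b d e f).eigenvectorBasis m 1 : ℝ) : ℂ) * (((genMat_isHermitian a b d e f).eigenvectorBasis m 2 : ℝ) : ℂ)
    ∧ -(((a : ℝ) : ℂ) + ((b : ℝ) : ℂ)) = ∑ m : Fin 3, (((genMat_isHermitian a b d e f).eigenvalues m : ℝ) : ℂ)
          * (((genMat_isHermitian a b d e f).eigenvectorBasis m 2 : ℝ) : ℂ)
            * (((genMat_isHermitian a b d e f).eigenvectorBasis m 2 : ℝ) : ℂ) := by
  have h00 := genMat_apply_eq_sum a b d e f 0 0
  have h11 := genMat_apply_eq_sum a b d e f 1 1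
  have h01 := genMat_apply_eq_sum a b d e f 0 1
  have h02 := genMat_apply_eq_sum a b d e f 0 2
  have h12 := genMat_apply_eq_sum a b d e f 1 2
  have h22 := genMat_apply_eq_sum a b d e f 2 2
  simp only [genMat, Matrix.of_apply, Matrix.cons_val', Matrix.cons_val_zero, Matrix.cons_val_one, Matrix.cons_val_two,
    Matrix.empty_val', Matrix.cons_val_fin_one, Matrix.head_cons, Matrix.tail_cons] at h00 h11 h01 h02 h12 h22
  refine ⟨?_, ?_, ?_, ?_, ?_, ?_⟩
  · exact_mod_cast congrArg (fun r : ℝ => (r : ℂ)) h00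
  · exact_mod_cast congrArg (fun r : ℝ => (r : ℂ)) h11
  · exact_mod_cast congrArg (fun r : ℝ => (r : ℂ)) h01
  · exact_mod_cast congrArg (fun r : ℝ => (r : ℂ)) h02
  · exact_mod_cast congrArg (fun r : ℝ => (r : ℂ)) h12
  · exact_mod_cast congrArg (fun r : ℝ => (r : ℂ)) h22

/-- `L(ε) = Σ_m λ_m ℓ_m²`. [folklore] -/
theorem eval_genL_eq_sum (ε : Fin 3 → ℂ) :
    eval ε (map (algebraMap ℝ ℂ) (genL a b d e f)) = ∑ m : Fin 3, (((genMat_isHermitian a b d e f).eigenvalues m : ℝ) : ℂ)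
          * (∑ i : Fin 3, (((genMat_isHermitian a b d e f).eigenvectorBasis m i : ℝ) : ℂ) * ε i) ^ 2 := by
  obtain ⟨qa, qb, qd, qe, qf, qc⟩ := genMat_entries_eq_sum a b d e f
  rw [Fin.sum_univ_three] at qa qb qd qe qf qc
  rw [eval_map_genL]
  simp only [Fin.sum_univ_three]
  linear_combination (ε 0 ^ 2) * qa + (ε 1 ^ 2) * qb + (ε 2 ^ 2) * qc + (2 * ε 0 * ε 1) * qd
    + (2 * ε 0 * ε 2) * qe + (2 * ε 1 * ε 2) * qf

/-- `M(ε) = Σ_m λ_m² ℓ_m²` (row orthonormality of the eigenframe). [folklore] -/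
theorem eval_genM_eq_sum (ε : Fin 3 → ℂ) :
    eval ε (map (algebraMap ℝ ℂ) (genM a b d e f)) = ∑ m : Fin 3, (((genMat_isHermitian a b d e f).eigenvalues m : ℝ) : ℂ) ^ 2
          * (∑ i : Fin 3, (((genMat_isHermitian a b d e f).eigenvectorBasis m i : ℝ) : ℂ) * ε i) ^ 2 := by
  obtain ⟨qa, qb, qd, qe, qf, qc⟩ := genMat_entries_eq_sum a b d e f
  rw [Fin.sum_univ_three] at qa qb qd qe qf qc
  have qc' : ((a : ℝ) : ℂ) + ((b : ℝ) : ℂ) = -((((genMat_isHermitian a b d e f).eigenvalues 0 : ℝ) : ℂ)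
        * (((genMat_isHermitian a b d e f).eigenvectorBasis 0 2 : ℝ) : ℂ) * (((genMat_isHermitian a b d e f).eigenvectorBasis 0 2 : ℝ) : ℂ)
        + (((genMat_isHermitian a b d e f).eigenvalues 1 : ℝ) : ℂ) * (((genMat_isHermitian a b d e f).eigenvectorBasis 1 2 : ℝ) : ℂ)
        * (((genMat_isHermitian a b d e f).eigenvectorBasis 1 2 : ℝ) : ℂ) + (((genMat_isHermitian a b d e f).eigenvalues 2 : ℝ) : ℂ)
        * (((genMat_isHermitian a b d e f).eigenvectorBasis 2 2 : ℝ) : ℂ)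
          * (((genMat_isHermitian a b d e f).eigenvectorBasis 2 2 : ℝ) : ℂ)) := by
    rw [← qc, neg_neg]
  have hr := fun m n => eigenvectorBasis_mul_sum a b d e f m n
  have r00 : _ = (1 : ℝ) := (hr 0 0).trans (if_pos rfl)
  have r11 : _ = (1 : ℝ) := (hr 1 1).trans (if_pos rfl)
  have r22 : _ = (1 : ℝ) := (hr 2 2).trans (if_pos rfl)
  have r01 : _ = (0 : ℝ) := (hr 0 1).trans (if_neg (by decide))
  have r02 : _ = (0 : ℝ) := (hr 0 2).trans (if_neg (by decide))
  have r12 : _ = (0 : ℝ) := (hr 1 2).trans (if_neg (by decide))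
  rw [Fin.sum_univ_three] at r00 r11 r22 r01 r02 r12
  have s00 := congrArg (fun r : ℝ => (r : ℂ)) r00
  have s11 := congrArg (fun r : ℝ => (r : ℂ)) r11
  have s22 := congrArg (fun r : ℝ => (r : ℂ)) r22
  have s01 := congrArg (fun r : ℝ => (r : ℂ)) r01
  have s02 := congrArg (fun r : ℝ => (r : ℂ)) r02
  have s12 := congrArg (fun r : ℝ => (r : ℂ)) r12
  push_cast at s00 s11 s22 s01 s02 s12
  rw [eval_map_genM, qc', qd, qe, qf, qa, qb]
  simp only [Fin.sum_univ_three]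
  linear_combination ((((genMat_isHermitian a b d e f).eigenvalues 0 : ℝ) : ℂ) * (((genMat_isHermitian a b d e f).eigenvalues 0 : ℝ) : ℂ)
        * ((((genMat_isHermitian a b d e f).eigenvectorBasis 0 0 : ℝ) : ℂ) * ε 0
        + (((genMat_isHermitian a b d e f).eigenvectorBasis 0 1 : ℝ) : ℂ) * ε 1
        + (((genMat_isHermitian a b d e f).eigenvectorBasis 0 2 : ℝ) : ℂ) * ε 2)
        * ((((genMat_isHermitian a b d e f).eigenvectorBasis 0 0 : ℝ) : ℂ) * ε 0
        + (((genMat_isHermitian a b d e f).eigenvectorBasis 0 1 : ℝ) : ℂ) * ε 1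
        + (((genMat_isHermitian a b d e f).eigenvectorBasis 0 2 : ℝ) : ℂ) * ε 2)) * s00
    + ((((genMat_isHermitian a b d e f).eigenvalues 1 : ℝ) : ℂ) * (((genMat_isHermitian a b d e f).eigenvalues 1 : ℝ) : ℂ)
          * ((((genMat_isHermitian a b d e f).eigenvectorBasis 1 0 : ℝ) : ℂ) * ε 0
          + (((genMat_isHermitian a b d e f).eigenvectorBasis 1 1 : ℝ) : ℂ) * ε 1
          + (((genMat_isHermitian a b d e f).eigenvectorBasis 1 2 : ℝ) : ℂ) * ε 2)
          * ((((genMat_isHermitian a b d e f).eigenvectorBasis 1 0 : ℝ) : ℂ) * ε 0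
          + (((genMat_isHermitian a b d e f).eigenvectorBasis 1 1 : ℝ) : ℂ) * ε 1
          + (((genMat_isHermitian a b d e f).eigenvectorBasis 1 2 : ℝ) : ℂ) * ε 2)) * s11
    + ((((genMat_isHermitian a b d e f).eigenvalues 2 : ℝ) : ℂ) * (((genMat_isHermitian a b d e f).eigenvalues 2 : ℝ) : ℂ)
          * ((((genMat_isHermitian a b d e f).eigenvectorBasis 2 0 : ℝ) : ℂ) * ε 0
          + (((genMat_isHermitian a b d e f).eigenvectorBasis 2 1 : ℝ) : ℂ) * ε 1
          + (((genMat_isHermitian a b d e f).eigenvectorBasis 2 2 : ℝ) : ℂ) * ε 2)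
          * ((((genMat_isHermitian a b d e f).eigenvectorBasis 2 0 : ℝ) : ℂ) * ε 0
          + (((genMat_isHermitian a b d e f).eigenvectorBasis 2 1 : ℝ) : ℂ) * ε 1
          + (((genMat_isHermitian a b d e f).eigenvectorBasis 2 2 : ℝ) : ℂ) * ε 2)) * s22
    + (2 * (((genMat_isHermitian a b d e f).eigenvalues 0 : ℝ) : ℂ) * (((genMat_isHermitian a b d e f).eigenvalues 1 : ℝ) : ℂ)
          * ((((genMat_isHermitian a b d e f).eigenvectorBasis 0 0 : ℝ) : ℂ) * ε 0
          + (((genMat_isHermitian a b d e f).eigenvectorBasis 0 1 : ℝ) : ℂ) * ε 1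
          + (((genMat_isHermitian a b d e f).eigenvectorBasis 0 2 : ℝ) : ℂ) * ε 2)
          * ((((genMat_isHermitian a b d e f).eigenvectorBasis 1 0 : ℝ) : ℂ) * ε 0
          + (((genMat_isHermitian a b d e f).eigenvectorBasis 1 1 : ℝ) : ℂ) * ε 1
          + (((genMat_isHermitian a b d e f).eigenvectorBasis 1 2 : ℝ) : ℂ) * ε 2)) * s01
    + (2 * (((genMat_isHermitian a b d e f).eigenvalues 0 : ℝ) : ℂ) * (((genMat_isHermitian a b d e f).eigenvalues 2 : ℝ) : ℂ)
          * ((((genMat_isHermitian a b d e f).eigenvectorBasis 0 0 : ℝ) : ℂ) * ε 0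
          + (((genMat_isHermitian a b d e f).eigenvectorBasis 0 1 : ℝ) : ℂ) * ε 1
          + (((genMat_isHermitian a b d e f).eigenvectorBasis 0 2 : ℝ) : ℂ) * ε 2)
          * ((((genMat_isHermitian a b d e f).eigenvectorBasis 2 0 : ℝ) : ℂ) * ε 0
          + (((genMat_isHermitian a b d e f).eigenvectorBasis 2 1 : ℝ) : ℂ) * ε 1
          + (((genMat_isHermitian a b d e f).eigenvectorBasis 2 2 : ℝ) : ℂ) * ε 2)) * s02
    + (2 * (((genMat_isHermitian a b d e f).eigenvalues 1 : ℝ) : ℂ) * (((genMat_isHermitian a b d e f).eigenvalues 2 : ℝ) : ℂ)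
          * ((((genMat_isHermitian a b d e f).eigenvectorBasis 1 0 : ℝ) : ℂ) * ε 0
          + (((genMat_isHermitian a b d e f).eigenvectorBasis 1 1 : ℝ) : ℂ) * ε 1
          + (((genMat_isHermitian a b d e f).eigenvectorBasis 1 2 : ℝ) : ℂ) * ε 2)
          * ((((genMat_isHermitian a b d e f).eigenvectorBasis 2 0 : ℝ) : ℂ) * ε 0
          + (((genMat_isHermitian a b d e f).eigenvectorBasis 2 1 : ℝ) : ℂ) * ε 1
          + (((genMat_isHermitian a b d e f).eigenvectorBasis 2 2 : ℝ) : ℂ) * ε 2)) * s12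

/-! ### Vandermonde: the generator's zeros on the complex null cone -/

/-- The `3 × 3` Vandermonde system with distinct nodes has only the trivial solution. [folklore] -/
theorem vandermonde_three {l0 l1 l2 u0 u1 u2 : ℂ} (h01 : l0 ≠ l1) (h02 : l0 ≠ l2) (h12 : l1 ≠ l2)
    (e1 : u0 + u1 + u2 = 0) (e2 : l0 * u0 + l1 * u1 + l2 * u2 = 0) (e3 : l0 ^ 2 * u0 + l1 ^ 2 * u1 + l2 ^ 2 * u2 = 0) :
    u0 = 0 ∧ u1 = 0 ∧ u2 = 0 := by
  have g0 : u0 * ((l0 - l1) * (l0 - l2)) = 0 := by linear_combination e3 - (l1 + l2) * e2 + l1 * l2 * e1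
  have g1 : u1 * ((l1 - l0) * (l1 - l2)) = 0 := by linear_combination e3 - (l0 + l2) * e2 + l0 * l2 * e1
  have g2 : u2 * ((l2 - l0) * (l2 - l1)) = 0 := by linear_combination e3 - (l0 + l1) * e2 + l0 * l1 * e1
  refine ⟨?_, ?_, ?_⟩
  · exact (mul_eq_zero.mp g0).resolve_right (mul_ne_zero (sub_ne_zero.mpr h01) (sub_ne_zero.mpr h02))
  · exact (mul_eq_zero.mp g1).resolve_right (mul_ne_zero (sub_ne_zero.mpr (Ne.symm h01)) (sub_ne_zero.mpr h12))
  · exact (mul_eq_zero.mp g2).resolve_right (mul_ne_zero (sub_ne_zero.mpr (Ne.symm h02)) (sub_ne_zero.mpr (Ne.symm h12)))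

/-- Column completeness: `ℓ_m(ε) = 0` for all `m` forces `ε = 0`. [folklore] -/
theorem eq_zero_of_frame_forms_eq_zero {ε : Fin 3 → ℂ}
    (h0 : ((((genMat_isHermitian a b d e f).eigenvectorBasis 0 0 : ℝ) : ℂ) * ε 0
          + (((genMat_isHermitian a b d e f).eigenvectorBasis 0 1 : ℝ) : ℂ) * ε 1
          + (((genMat_isHermitian a b d e f).eigenvectorBasis 0 2 : ℝ) : ℂ) * ε 2)
          = 0) (h1 : ((((genMat_isHermitian a b d e f).eigenvectorBasis 1 0 : ℝ) : ℂ) * ε 0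
          + (((genMat_isHermitian a b d e f).eigenvectorBasis 1 1 : ℝ) : ℂ) * ε 1
          + (((genMat_isHermitian a b d e f).eigenvectorBasis 1 2 : ℝ) : ℂ) * ε 2)
          = 0) (h2 : ((((genMat_isHermitian a b d e f).eigenvectorBasis 2 0 : ℝ) : ℂ) * ε 0
          + (((genMat_isHermitian a b d e f).eigenvectorBasis 2 1 : ℝ) : ℂ) * ε 1
          + (((genMat_isHermitian a b d e f).eigenvectorBasis 2 2 : ℝ) : ℂ) * ε 2) = 0) : ε = 0 := by
  have hc := fun i j => sum_eigenvectorBasis_mul a b d e f i j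
  have h00 : _ = (1 : ℝ) := (hc 0 0).trans (if_pos rfl)
  have h11 : _ = (1 : ℝ) := (hc 1 1).trans (if_pos rfl)
  have h22 : _ = (1 : ℝ) := (hc 2 2).trans (if_pos rfl)
  have h01 : _ = (0 : ℝ) := (hc 0 1).trans (if_neg (by decide))
  have h02 : _ = (0 : ℝ) := (hc 0 2).trans (if_neg (by decide))
  have h12 : _ = (0 : ℝ) := (hc 1 2).trans (if_neg (by decide))
  rw [Fin.sum_univ_three] at h00 h11 h22 h01 h02 h12
  have g00 := congrArg (fun r : ℝ => (r : ℂ)) h00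
  have g11 := congrArg (fun r : ℝ => (r : ℂ)) h11
  have g22 := congrArg (fun r : ℝ => (r : ℂ)) h22
  have g01 := congrArg (fun r : ℝ => (r : ℂ)) h01
  have g02 := congrArg (fun r : ℝ => (r : ℂ)) h02
  have g12 := congrArg (fun r : ℝ => (r : ℂ)) h12
  push_cast at g00 g11 g22 g01 g02 g12
  funext i
  fin_cases i
  · change ε 0 = 0
    linear_combination (-(ε 0)) * g00 + (-(ε 1)) * g01 + (-(ε 2)) * g02 + (((genMat_isHermitian a b d e f).eigenvectorBasis 0 0 : ℝ) : ℂ) * h0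
          + (((genMat_isHermitian a b d e f).eigenvectorBasis 1 0 : ℝ) : ℂ) * h1
          + (((genMat_isHermitian a b d e f).eigenvectorBasis 2 0 : ℝ) : ℂ) * h2
  · change ε 1 = 0
    linear_combination (-(ε 0)) * g01 + (-(ε 1)) * g11 + (-(ε 2)) * g12 + (((genMat_isHermitian a b d e f).eigenvectorBasis 0 1 : ℝ) : ℂ) * h0
          + (((genMat_isHermitian a b d e f).eigenvectorBasis 1 1 : ℝ) : ℂ) * h1
          + (((genMat_isHermitian a b d e f).eigenvectorBasis 2 1 : ℝ) : ℂ) * h2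
  · change ε 2 = 0
    linear_combination (-(ε 0)) * g02 + (-(ε 1)) * g12 + (-(ε 2)) * g22 + (((genMat_isHermitian a b d e f).eigenvectorBasis 0 2 : ℝ) : ℂ) * h0
          + (((genMat_isHermitian a b d e f).eigenvectorBasis 1 2 : ℝ) : ℂ) * h1
          + (((genMat_isHermitian a b d e f).eigenvectorBasis 2 2 : ℝ) : ℂ) * h2

/-- Conversely to `eigenvalues_sq_of_genM_eq`: if every eigenvalue satisfies `λ² = βλ + γ` then `M = βL + γρ`. [folklore] -/
theorem genM_eq_of_eigenvalues_sq {β γ : ℝ} (h : ∀ m : Fin 3, (genMat_isHermitian a b d e f).eigenvalues m ^ 2 = β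
      * (genMat_isHermitian a b d e f).eigenvalues m + γ) :
    genM a b d e f = C β * genL a b d e f + C γ * normSq := by
  apply map_injective (algebraMap ℝ ℂ) (RCLike.ofReal_injective)
  apply MvPolynomial.funext
  intro ε
  have g0 := congrArg (fun r : ℝ => (r : ℂ)) (h 0)
  have g1 := congrArg (fun r : ℝ => (r : ℂ)) (h 1)
  have g2 := congrArg (fun r : ℝ => (r : ℂ)) (h 2)
  push_cast at g0 g1 g2
  rw [map_add, map_mul, map_mul, map_C, map_C, map_normSq, map_add, map_mul, map_mul, eval_C, eval_C, eval_genM_eq_sum,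
    eval_genL_eq_sum]
  rw [show eval ε (normSq : MvPolynomial (Fin 3) ℂ) = eval ε (map (algebraMap ℝ ℂ) (normSq : RPoly)) by rw [map_normSq],
    eval_normSq_eq_sum_sq a b d e f]
  simp only [Fin.sum_univ_three]
  change _ = ((β : ℝ) : ℂ) * _ + ((γ : ℝ) : ℂ) * _
  linear_combination ((((genMat_isHermitian a b d e f).eigenvectorBasis 0 0 : ℝ) : ℂ) * ε 0
        + (((genMat_isHermitian a b d e f).eigenvectorBasis 0 1 : ℝ) : ℂ) * ε 1
        + (((genMat_isHermitian a b d e f).eigenvectorBasis 0 2 : ℝ) : ℂ) * ε 2) ^ 2 * g0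
        + ((((genMat_isHermitian a b d e f).eigenvectorBasis 1 0 : ℝ) : ℂ) * ε 0
        + (((genMat_isHermitian a b d e f).eigenvectorBasis 1 1 : ℝ) : ℂ) * ε 1
        + (((genMat_isHermitian a b d e f).eigenvectorBasis 1 2 : ℝ) : ℂ) * ε 2) ^ 2 * g1
        + ((((genMat_isHermitian a b d e f).eigenvectorBasis 2 0 : ℝ) : ℂ) * ε 0
        + (((genMat_isHermitian a b d e f).eigenvectorBasis 2 1 : ℝ) : ℂ) * ε 1
        + (((genMat_isHermitian a b d e f).eigenvectorBasis 2 2 : ℝ) : ℂ) * ε 2) ^ 2 * g2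

/-- ★ A REPEATED EIGENVALUE KILLS `W = det(x, Qx, Q²x)`. [folklore] -/
theorem genW_eq_zero_of_eigenvalues_eq {i j : Fin 3} (hij : i ≠ j) (h : (genMat_isHermitian a b d e f).eigenvalues i
      = (genMat_isHermitian a b d e f).eigenvalues j) : genW a b d e f = 0 := by
  -- the third index `k` and the quadratic relation `λ² = (λᵢ + λ_k)λ − λᵢλ_k` for all three eigenvalues
  obtain ⟨k, hki, hkj, hall⟩ : ∃ k : Fin 3, k ≠ i ∧ k ≠ j ∧ ∀ m : Fin 3, m = i ∨ m = j ∨ m = k := by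
    fin_cases i <;> fin_cases j <;> simp (config := {decide := true}) at hij ⊢
  have hsq : ∀ m : Fin 3, (genMat_isHermitian a b d e f).eigenvalues m ^ 2 = ((genMat_isHermitian a b d e f).eigenvalues i
        + (genMat_isHermitian a b d e f).eigenvalues k) * (genMat_isHermitian a b d e f).eigenvalues m
        + (-((genMat_isHermitian a b d e f).eigenvalues i * (genMat_isHermitian a b d e f).eigenvalues k)) := by
    intro m
    rcases hall m with rfl | rfl | rfl
    · ring
    · rw [← h]; ring
    · ring
  have hM := genM_eq_of_eigenvalues_sq a b d e f hsq
  have h4 : C (4 : ℝ) * genW a b d e f = 0 := by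
    rw [← detP_genL_genM, hM, detP_add_right, detP_C_mul_right, detP_C_mul_right, detP_self, detP_normSq_right,
      mul_zero, mul_zero, add_zero]
  rcases mul_eq_zero.mp h4 with h0 | h0
  · exact absurd (C_eq_zero.mp h0) (by norm_num)
  · exact h0

/-- ★ THE GENERATOR'S ZEROS ON THE COMPLEX NULL CONE: if `W ≢ 0` (no repeated eigenvalue), no non-zero complex isotropic vector
is a common zero of `L` and `M`. [folklore] -/
theorem eq_zero_of_cone_zero (hW : genW a b d e f ≠ 0) {ε : Fin 3 → ℂ}
    (hρ : eval ε (map (algebraMap ℝ ℂ) (normSq : RPoly)) = 0) (hL : eval ε (map (algebraMap ℝ ℂ) (genL a b d e f)) = 0)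
    (hM : eval ε (map (algebraMap ℝ ℂ) (genM a b d e f)) = 0) : ε = 0 := by
  have hd : ∀ i j : Fin 3, i ≠ j → (genMat_isHermitian a b d e f).eigenvalues i ≠ (genMat_isHermitian a b d e f).eigenvalues j :=
    fun i j hij h => hW (genW_eq_zero_of_eigenvalues_eq a b d e f hij h)
  have h01 : (((genMat_isHermitian a b d e f).eigenvalues 0 : ℝ) : ℂ)
      ≠ (((genMat_isHermitian a b d e f).eigenvalues 1 : ℝ) : ℂ) :=
    fun h => hd 0 1 (by decide) (by exact_mod_cast h)
  have h02 : (((genMat_isHermitian a b d e f).eigenvalues 0 : ℝ) : ℂ)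
      ≠ (((genMat_isHermitian a b d e f).eigenvalues 2 : ℝ) : ℂ) :=
    fun h => hd 0 2 (by decide) (by exact_mod_cast h)
  have h12 : (((genMat_isHermitian a b d e f).eigenvalues 1 : ℝ) : ℂ)
      ≠ (((genMat_isHermitian a b d e f).eigenvalues 2 : ℝ) : ℂ) :=
    fun h => hd 1 2 (by decide) (by exact_mod_cast h)
  rw [eval_normSq_eq_sum_sq a b d e f, Fin.sum_univ_three] at hρ
  rw [eval_genL_eq_sum, Fin.sum_univ_three] at hL
  rw [eval_genM_eq_sum, Fin.sum_univ_three] at hM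
  simp only [Fin.sum_univ_three] at hρ hL hM
  obtain ⟨u0, u1, u2⟩ := vandermonde_three h01 h02 h12 hρ hL hM
  exact eq_zero_of_frame_forms_eq_zero a b d e f ((pow_eq_zero_iff two_ne_zero).mp u0)
    ((pow_eq_zero_iff two_ne_zero).mp u1) ((pow_eq_zero_iff two_ne_zero).mp u2)

end Zonal

end Summit.NavierStokesRegularity.NavierStokesRegularity.Theorems.PoloidalLiouville.HorizonTower

end
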